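/-
Copyright (c) 2026 the pub-hodgecm-mathlib formalisation cell (harness21).  Prover seat hodgecm-mathlib-A-p06 (g28) — (U) road, U2 FILE D «𝔲(J) place by place», 2026-09-01.
-/
import Literature.NumberTheory.Weil1964.UnitaryArchTopFormHaarCM       -- ★ `map_evalC_of_mem_archSkew`, `mem_archSkew_of_forall_evalC`, `traceForm_eq_sum`
import Literature.NumberTheory.Weil1964.UnitaryArchLocalTopFormHaar     -- ★ FILE B (A-p06 g28): `skewC`, `traceFormC`, `skewMulLC`
import Literature.NumberTheory.Automorphic.UnitaryGroupArchCayleyJacobian  -- ★ `skewMulL`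
import HarnessLib

/-!
# `𝔲(J)(E ⊗ ℝ) ≃ Π_w 𝔲(σ_w J)(ℂ)` — the Lie algebra of the archimedean unitary group, place by place ((U) road, U2 FILE D)

Topic `NumberTheory/Weil1964`, namespace `Literature.NumberTheory.Weil1964.UnitaryArchTopForm`.  TWO DEFINITIONS WITH BODY (`skewPiEquiv`, its CM reading
`skewPiEquivCM`) + apply ∕ compatibility theorems; no named fact, no instance, no notation, no `sorry`.  Cell `pub/hodgecm-mathlib`, crux H413 =
`stmt-HodgeConjecture-24833` (supports only); (U) road U2 «product theorem» (LEAD T9-34 (2) ∕ T9-36; owner A-p19 (g24)).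

In the CM situation (`c ≠ 1` fixing every infinite place of `E`, so `E ⊗ ℝ = ℂ^{r₂}`), a matrix `X` over `E ⊗ ℝ` lies in `𝔲(J) = archSkew F E c N J` iff each
coordinate `X_w = X.map (evalC E w)` lies in the one-place Lie algebra `𝔲(σ_w J) = skewC N (J.map σ_w)` (★ `map_evalC_of_mem_archSkew` ∕ ★ `mem_archSkew_of_forall_evalC`);
`skewPiEquiv` packages this as a continuous `ℝ`-linear equivalence.  It carries the global Jacobian endomorphism `m_Y : H ↦ (1 − Y) H (1 + Y)` (★ `skewMulL`) to the
family of the one-place ones (★ `skewMulLC`, `skewPiEquiv_skewMulL`) and splits the trace form `β(X, Y) = Re tr(XY)` as `∑_w β_w(X_w, Y_w)`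
(`traceForm_eq_sum_traceFormC`, over ★ `traceForm_eq_sum`) — the two inputs of the product theorem `μ^TF ↦ ⊗_w μ^TF_w` (U2 FILEs E∕F).
HONEST LABEL: HC_CM is proved only modulo the 2 remaining named inputs (hLiu418 24832, h413 24833) until rung 0 closes; nothing printed is discharged here.

## References
* J. D. Rogawski, *Automorphic Representations of Unitary Groups in Three Variables*, Ann. of Math. Stud. 123 (1990), §1.7 p. 6 («`G_∞ = ∏_{v∣∞} G_v`»). [Rogawski1990]
* A. W. Knapp, *Lie Groups Beyond an Introduction*, 2nd ed. (2002), I §1. [Knapp2002]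
-/

set_option autoImplicit false
-- submodule-normed vs subtype topologies on `↥(skewC …)` ∕ `↥(archSkew …)` (as in ★ FILE B ∕ ★ `UnitaryArchTopFormHaar`)
set_option backward.isDefEq.respectTransparency false

noncomputable section

open MeasureTheory NumberField NumberField.InfinitePlace NumberField.mixedEmbedding
open scoped Classical Matrix MatrixGroups

namespace Literature.NumberTheory.Weil1964

namespace UnitaryArchTopForm

open Literature.NumberTheory.Automorphic Literature.NumberTheory.Automorphic.UnitaryGroup Literature.NumberTheory.Weil1964.UnitaryArchLocalTopForm

section Places

variable (F E : Type) [Field F] [Field E] [NumberField E] [Algebra F E] (c : E ≃ₐ[F] E) (N : ℕ) (J : Matrix (Fin N) (Fin N) E)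

omit [NumberField E] in
/-- The matrix over `E ⊗ ℝ = ℂ^{r₂}` with prescribed complex coordinates (no real place in the CM situation). [cite: Knapp2002, I §1] -/
theorem map_evalC_matrixOfPlaces (Y : {w : InfinitePlace E // IsComplex w} → Matrix (Fin N) (Fin N) ℂ) (w : {w : InfinitePlace E // IsComplex w}) :
    (Matrix.of fun i j => ((0 : {v : InfinitePlace E // IsReal v} → ℝ), fun v => Y v i j) : Matrix (Fin N) (Fin N) (mixedSpace E)).map (evalC E w) = Y w := by
  ext i j
  simp only [Matrix.map_apply, Matrix.of_apply, evalC_apply]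

/-- **`𝔲(J)(E ⊗ ℝ) ≃L[ℝ] Π_w 𝔲(σ_w J)(ℂ)`**, `X ↦ (X_w)_w` with `X_w = X.map (evalC E w)` — the Lie algebra of `U(J)(E ⊗ ℝ) = Π_w U(σ_w J)(ℂ)` place by place,
for `c ≠ 1` fixing every infinite place. [cite: Rogawski1990, §1.7 p. 6] [cite: Knapp2002, I §1] -/
def skewPiEquiv (hc : c ≠ 1) (hfix : ∀ w : InfinitePlace E, c • w = w) :
    ↥(archSkew F E c N J) ≃L[ℝ] ((w : {w : InfinitePlace E // IsComplex w}) → ↥(skewC N (J.map w.1.embedding))) where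
  toFun X := fun w => ⟨(X : Matrix (Fin N) (Fin N) (mixedSpace E)).map (evalC E w), map_evalC_of_mem_archSkew J hc hfix X.2 w⟩
  invFun Y := ⟨Matrix.of fun i j => ((0 : {v : InfinitePlace E // IsReal v} → ℝ), fun v => (Y v : Matrix (Fin N) (Fin N) ℂ) i j),
    mem_archSkew_of_forall_evalC J hc hfix fun w => by
      rw [map_evalC_matrixOfPlaces]; exact (Y w).2⟩
  map_add' X Y := funext fun w => Subtype.ext (by simp only [Submodule.coe_add, Pi.add_apply]; exact Matrix.map_add _ (map_add (evalC E w)) _ _)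
  map_smul' t X := funext fun w => Subtype.ext (by
    ext i j
    simp only [Submodule.coe_smul, RingHom.id_apply, Pi.smul_apply, Matrix.map_apply, Matrix.smul_apply, evalC_apply]
    rfl)
  left_inv X := Subtype.ext (eq_of_forall_map_evalC (F := F) (c := c) hc hfix fun w => map_evalC_matrixOfPlaces E N _ w)
  right_inv Y := funext fun w => Subtype.ext (map_evalC_matrixOfPlaces E N (fun v => (Y v : Matrix (Fin N) (Fin N) ℂ)) w)
  continuous_toFun := continuous_pi fun w =>
    ((continuous_id.matrix_map (continuous_evalC E w)).comp continuous_subtype_val).subtype_mk _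
  continuous_invFun := by
    refine Continuous.subtype_mk (continuous_pi fun i => continuous_pi fun j => continuous_const.prodMk (continuous_pi fun v => ?_)) _
    exact (continuous_apply j).comp ((continuous_apply i).comp (continuous_subtype_val.comp (continuous_apply v)))

variable {F E c N J}

omit [NumberField E] in
/-- `(skewPiEquiv X)_w = X.map (evalC E w)` as a matrix. [cite: Knapp2002, I §1] -/
@[simp] theorem coe_skewPiEquiv_apply (hc : c ≠ 1) (hfix : ∀ w : InfinitePlace E, c • w = w) (X : archSkew F E c N J)
    (w : {w : InfinitePlace E // IsComplex w}) :
    ((skewPiEquiv F E c N J hc hfix X w : skewC N (J.map w.1.embedding)) : Matrix (Fin N) (Fin N) ℂ) =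
      (X : Matrix (Fin N) (Fin N) (mixedSpace E)).map (evalC E w) := rfl

omit [NumberField E] in
/-- `(skewPiEquiv.symm Y)_w = Y_w` as a matrix. [cite: Knapp2002, I §1] -/
@[simp] theorem map_evalC_skewPiEquiv_symm (hc : c ≠ 1) (hfix : ∀ w : InfinitePlace E, c • w = w)
    (Y : (w : {w : InfinitePlace E // IsComplex w}) → ↥(skewC N (J.map w.1.embedding))) (w : {w : InfinitePlace E // IsComplex w}) :
    (((skewPiEquiv F E c N J hc hfix).symm Y : archSkew F E c N J) : Matrix (Fin N) (Fin N) (mixedSpace E)).map (evalC E w) =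
      (Y w : Matrix (Fin N) (Fin N) ℂ) :=
  map_evalC_matrixOfPlaces E N (fun v => (Y v : Matrix (Fin N) (Fin N) ℂ)) w

/-- **`m_Y` place by place**: `(m_Y H)_w = m_{Y_w} H_w`, i.e. `skewPiEquiv ∘ skewMulL Y = (Π_w skewMulLC Y_w) ∘ skewPiEquiv`. [cite: Weyl1939, Ch. II §10] [cite: Knapp2002, I §1] -/
theorem skewPiEquiv_skewMulL (hc : c ≠ 1) (hfix : ∀ w : InfinitePlace E, c • w = w) (Y H : archSkew F E c N J)
    (w : {w : InfinitePlace E // IsComplex w}) :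
    skewPiEquiv F E c N J hc hfix (skewMulL F E c N J Y H) w =
      skewMulLC N (J.map w.1.embedding) (skewPiEquiv F E c N J hc hfix Y w) (skewPiEquiv F E c N J hc hfix H w) := by
  apply Subtype.ext
  rw [coe_skewPiEquiv_apply, coe_skewMulL_apply, coe_skewMulLC_apply, coe_skewPiEquiv_apply, coe_skewPiEquiv_apply]
  change (evalC E w).mapMatrix _ = _
  rw [map_mul, map_mul, map_add, map_sub, map_one]
  rfl

/-- `skewPiEquiv` conjugates `m_Y` to the place-wise family: `skewPiEquiv ∘ m_Y ∘ skewPiEquiv⁻¹ = Π_w m_{Y_w}` as linear maps (the shape `LinearMap.det_conj` ∕ a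
dependent `LinearMap.det_pi` consume). [cite: Weyl1939, Ch. II §10] -/
theorem conj_skewMulL (hc : c ≠ 1) (hfix : ∀ w : InfinitePlace E, c • w = w) (Y : archSkew F E c N J) :
    (skewPiEquiv F E c N J hc hfix).toLinearEquiv.conj (skewMulL F E c N J Y).toLinearMap =
      LinearMap.pi (φ := fun w : {w : InfinitePlace E // IsComplex w} => ↥(skewC N (J.map w.1.embedding)))
        fun w => (skewMulLC N (J.map w.1.embedding) (skewPiEquiv F E c N J hc hfix Y w)).toLinearMap.comp
          (LinearMap.proj (φ := fun w : {w : InfinitePlace E // IsComplex w} => ↥(skewC N (J.map w.1.embedding))) w) := by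
  refine LinearMap.ext fun Z => funext fun w => ?_
  rw [LinearEquiv.conj_apply_apply, LinearMap.pi_apply, LinearMap.comp_apply, LinearMap.proj_apply, ContinuousLinearMap.coe_coe,
    ContinuousLinearMap.coe_coe, ContinuousLinearEquiv.coe_toLinearEquiv, skewPiEquiv_skewMulL hc hfix,
    ContinuousLinearEquiv.coe_symm_toLinearEquiv, ContinuousLinearEquiv.apply_symm_apply]

/-- **The trace form place by place on `𝔲(J)`**: `β(X, Y) = ∑_w β_w(X_w, Y_w)`. [cite: Rogawski1990, §1.7 p. 6] [cite: Macdonald1980, p. 93] -/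
theorem traceForm_eq_sum_traceFormC (hc : c ≠ 1) (hfix : ∀ w : InfinitePlace E, c • w = w) (X Y : archSkew F E c N J) :
    traceForm E N (X : Matrix (Fin N) (Fin N) (mixedSpace E)) (Y : Matrix (Fin N) (Fin N) (mixedSpace E)) =
      ∑ w : {w : InfinitePlace E // IsComplex w},
        traceFormC N ((skewPiEquiv F E c N J hc hfix X w : skewC N (J.map w.1.embedding)) : Matrix (Fin N) (Fin N) ℂ)
          ((skewPiEquiv F E c N J hc hfix Y w : skewC N (J.map w.1.embedding)) : Matrix (Fin N) (Fin N) ℂ) := by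
  rw [traceForm_eq_sum (F := F) (c := c) hc hfix]
  rfl

/-- The Gram matrices place by place: `β(B i, B j) = ∑_w β_w((B i)_w, (B j)_w)` — ★ `lieGram` against the one-place ★ `lieGramC` after `skewPiEquiv`.
[cite: Macdonald1980, p. 93] -/
theorem lieGram_apply_eq_sum (hc : c ≠ 1) (hfix : ∀ w : InfinitePlace E, c • w = w) {ι : Type} (B : ι → archSkew F E c N J) (i j : ι) :
    lieGram J B i j = ∑ w : {w : InfinitePlace E // IsComplex w}, lieGramC (fun k => skewPiEquiv F E c N J hc hfix (B k) w) i j := by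
  rw [lieGram_apply, traceForm_eq_sum_traceFormC hc hfix]
  rfl

end Places

/-! ## The CM reading -/

section CM

variable (L : Type) [Field L] [NumberField L] [IsCMField L] (N : ℕ) (H : Matrix (Fin N) (Fin N) L)

/-- **CM case: `𝔲(H)(L ⊗ ℝ) ≃L[ℝ] Π_w 𝔲(σ_w H)(ℂ)`** over the complex places of the CM field `L` (`F = L⁺`, `c` = complex conjugation — the Lie-algebra companion
of ★ `archPiEquivCM`). [cite: Rogawski1990, §1.7 p. 6] -/
def skewPiEquivCM :
    ↥(archSkew (↥(maximalRealSubfield L)) L (IsCMField.complexConj L) N H) ≃L[ℝ]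
      ((w : {w : InfinitePlace L // IsComplex w}) → ↥(skewC N (H.map w.1.embedding))) :=
  skewPiEquiv _ L (IsCMField.complexConj L) N H (IsCMField.complexConj_ne_one L) (complexConj_smul_infinitePlace L)

/-- `skewPiEquivCM` is `skewPiEquiv` at complex conjugation. [cite: Rogawski1990, §1.7 p. 6] -/
theorem skewPiEquivCM_eq :
    skewPiEquivCM L N H = skewPiEquiv _ L (IsCMField.complexConj L) N H (IsCMField.complexConj_ne_one L) (complexConj_smul_infinitePlace L) := rfl

end CM

end UnitaryArchTopForm

end Literature.NumberTheory.Weil1964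

end
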